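import Mathlib
import Summits.ResolutionOfSingularities.ResolutionOfSingularities.Theorems.WeightedInvariantEssSmoothMonomialTypeDescent
import Summits.ResolutionOfSingularities.ResolutionOfSingularities.Theorems.WeightedInvariantContactCentreFiltrationBasic
import Summits.ResolutionOfSingularities.ResolutionOfSingularities.Theorems.WeightedInvariantContactFiltrationTerminal
import Summits.ResolutionOfSingularities.ResolutionOfSingularities.Theorems.WeightedInvariantHypersurfaceLocalGameEFT4SDimLETwoGameTerminal
import Summits.ResolutionOfSingularities.ResolutionOfSingularities.Theorems.WeightedInvariantFormallySmoothResidueBinomial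
import HarnessLib

/-!
# Contact levels are preserved and REFLECTED along essentially smooth local homomorphisms ((o24-C) core)

Topic: `Summits/ResolutionOfSingularities/ResolutionOfSingularities/Theorems`. Helper for the door item
`HypersurfaceCentreConstruction` (statement `stmt-ResolutionOfSingularities-19897`, route `WeightedInvariant`),
line `local-engine` of `res-L1-w43-plan-1` (L W4.3), ORDER (o24) rung P2, piece **(o24-C)** «(c11)↾≤2
`IotaJEssSmoothCompatibleLE2 iotaOrd jContact`» (hand res-type-078).  For a local, formally smooth,
essentially-of-finite-type homomorphism `φ : S → S'` of two-dimensional regular local rings with `𝔪 S' = 𝔪'` and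
`f ∈ 𝔪` of order `ν`, the set of contact levels `{b ≥ 1 | Reaches f ν b}` (`…ContactCentreFiltration`, p514802) is the
same for `f` in `S` and for `φ f` in `S'` (§3), hence `bMax (φ f) = bMax f` (§4).  ASCENT (§1) is transport of the contact
filtration (`(F_{g,b}(n)) S' = F_{φ g,b}(n)`).  DESCENT (§2–§3) is the STEP «`f` reaches `b` in `S`, `φ f` reaches `b+1` in
`S'` ⇒ `f` reaches `b+1` in `S`»: the reduction `exists_face_of_mem_succ` (C5, p513413) in `S'` makes the level-`b` face
of `φ f` a binomial row `r' (Y + μ' X^b)^ν` over the residue field `κ'`; comparing with the image of the `S`-face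
(uniqueness of faces modulo `𝔪'`, K5 `face_coeff_mem_maximalIdeal`) and the absence of new `p^e`-th roots in `κ'/κ`
(`…FormallySmoothResiduePthRoot`, p514699) make `μ'` residually `κ`-rational, so K5 `exists_steepen_of_face_eq_pow`
prepares `f` at level `b` in `S` along `y₁ = y - λ x^b`; then either `y₁` reaches `b+1`, or C5 `not_mem_succ_of_caseC`
— applied in `S'` to the image system — forbids every parameter of `S'` to reach `b+1`, contradiction.

[OURS · L1 W4.3] Replaces the role of NO printed item; NOT a statement of the manuscript
[claim: Hironaka2017, status: under-review]. AI work, weaker than expert review.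

## References

* H. Hironaka, *Characteristic polyhedra of singularities*, J. Math. Kyoto Univ. 7 (1967) 251–293. [Hironaka1967]
* V. Cossart, U. Jannsen, S. Saito, *Desingularization: invariants and strategy*, LNM 2270 (2020), Ch. 8.
  [CossartJannsenSaito2020]
* H. Matsumura, *Commutative Ring Theory*, §22–§23 and §28. [Matsumura1987]
-/

noncomputable section

open IsLocalRing Literature.AlgebraicGeometry.Resolution

set_option linter.dupNamespace false -- mandated namespace of this single-conjunct summit

namespace Summit.ResolutionOfSingularities.ResolutionOfSingularities.Theorems

namespace EssSmoothLevels

open Summit.ResolutionOfSingularities.ResolutionOfSingularities.Cruxes.HypersurfaceCentreConstruction.LocalEngine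
open Summit.ResolutionOfSingularities.ResolutionOfSingularities.Cruxes.HypersurfaceCentreConstruction.LocalEngine
  (IotaOrderEssSmooth.mem_maximalIdeal_pow_iff_of_formallySmooth IotaOrderEssSmooth.adicOrder_algebraMap_eq_of_formallySmooth)
open IotaOrderEssSmooth (mem_maximalIdeal_pow_iff_of_formallySmooth adicOrder_algebraMap_eq_of_formallySmooth)

/-! ## §1. Transport of the contact filtration (ascent) -/

section Transport

variable {S S' : Type} [CommRing S] [CommRing S'] [IsLocalRing S] [IsLocalRing S'] [Algebra S S']

/-- **Extension of the contact filtration**: `𝔪 S' = 𝔪'` ⇒ `(F_{g,b}(n)) S' = F_{φ g, b}(n)`. [folklore] -/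
theorem map_contactFiltration (h𝔪 : (maximalIdeal S).map (algebraMap S S') = maximalIdeal S') (g : S) (b n : ℕ) :
    (contactFiltration g b n).map (algebraMap S S') = contactFiltration (algebraMap S S' g) b n := by
  simp only [contactFiltration_def, Ideal.map_iSup, Ideal.map_mul, Ideal.map_pow, Ideal.map_span,
    Set.image_singleton, map_pow, h𝔪]

/-- A regular system of parameters extends: `(x, y) = 𝔪`, `𝔪 S' = 𝔪'` ⇒ `(φ x, φ y) = 𝔪'`. [folklore] -/
theorem span_pair_map (h𝔪 : (maximalIdeal S).map (algebraMap S S') = maximalIdeal S') {x y : S}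
    (hxy : Ideal.span {x, y} = maximalIdeal S) :
    Ideal.span {algebraMap S S' x, algebraMap S S' y} = maximalIdeal S' := by
  rw [← h𝔪, ← hxy, Ideal.map_span, Set.image_insert_eq, Set.image_singleton]

omit [IsLocalRing S] [IsLocalRing S'] in
/-- The image of a face. [folklore] -/
theorem map_face (a : ℕ → S) (x y : S) (b ν : ℕ) :
    algebraMap S S' (∑ j ∈ Finset.range (ν + 1), a j * (x ^ (b * (ν - j)) * y ^ j)) =
      ∑ j ∈ Finset.range (ν + 1), algebraMap S S' (a j) *
        (algebraMap S S' x ^ (b * (ν - j)) * algebraMap S S' y ^ j) := by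
  simp only [map_sum, map_mul, map_pow]

end Transport

section Reflect

variable {S S' : Type} [CommRing S] [CommRing S'] [IsRegularLocalRing S] [IsRegularLocalRing S'] [Algebra S S']
  [IsLocalHom (algebraMap S S')] [Algebra.FormallySmooth S S'] [Algebra.EssFiniteType S S']

/-- Membership in the contact filtration is preserved and reflected (faithful flatness, p517017). [folklore] -/
theorem algebraMap_mem_contactFiltration_iff (h𝔪 : (maximalIdeal S).map (algebraMap S S') = maximalIdeal S')
    (f g : S) (b n : ℕ) :
    algebraMap S S' f ∈ contactFiltration (algebraMap S S' g) b n ↔ f ∈ contactFiltration g b n := by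
  rw [← map_contactFiltration h𝔪]
  exact ⟨EssSmoothDescent.mem_of_algebraMap_mem_map, Ideal.mem_map_of_mem _⟩

omit [IsLocalHom (algebraMap S S')] [Algebra.FormallySmooth S S'] [Algebra.EssFiniteType S S'] in
/-- **Extension of the weighted filtration of a regular system** `(x, y)`, weights `(1, b)`, `b ≥ 1` (C1, p511384, on both
sides). [folklore] -/
theorem map_weightedMonomialIdeal_pair (h𝔪 : (maximalIdeal S).map (algebraMap S S') = maximalIdeal S') {x y : S}
    (hxy : Ideal.span {x, y} = maximalIdeal S) {b : ℕ} (hb : 1 ≤ b) (n : ℕ) :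
    (weightedMonomialIdeal ![x, y] ![1, b] n).map (algebraMap S S') =
      weightedMonomialIdeal ![algebraMap S S' x, algebraMap S S' y] ![1, b] n := by
  rw [ContactFiltration.weightedMonomialIdeal_eq_contactFiltration hxy hb,
    ContactFiltration.weightedMonomialIdeal_eq_contactFiltration (span_pair_map h𝔪 hxy) hb, ← contactFiltration_def,
    ← contactFiltration_def, map_contactFiltration h𝔪]

/-- Membership in the weighted filtration of a regular system is preserved and reflected. [folklore] -/
theorem algebraMap_mem_weightedMonomialIdeal_iff (h𝔪 : (maximalIdeal S).map (algebraMap S S') = maximalIdeal S')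
    {x y : S} (hxy : Ideal.span {x, y} = maximalIdeal S) {b : ℕ} (hb : 1 ≤ b) (n : ℕ) (f : S) :
    algebraMap S S' f ∈ weightedMonomialIdeal ![algebraMap S S' x, algebraMap S S' y] ![1, b] n ↔
      f ∈ weightedMonomialIdeal ![x, y] ![1, b] n := by
  rw [← map_weightedMonomialIdeal_pair h𝔪 hxy hb]
  exact ⟨EssSmoothDescent.mem_of_algebraMap_mem_map, Ideal.mem_map_of_mem _⟩

/-- **Levels ascend**: `Reaches f ν b ⇒ Reaches (φ f) ν b` (the parameter `φ g` serves; `φ g ∉ 𝔪'²` by p503771).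
[cite: Matsumura1987, §22 Cor. to Thm. 22.5] -/
theorem reaches_map (h𝔪 : (maximalIdeal S).map (algebraMap S S') = maximalIdeal S') {f : S} {ν b : ℕ}
    (h : Reaches f ν b) : Reaches (algebraMap S S' f) ν b := by
  obtain ⟨g, hg, hg2, hf⟩ := h
  exact ⟨algebraMap S S' g, map_nonunit _ _ hg,
    fun h2 => hg2 ((mem_maximalIdeal_pow_iff_of_formallySmooth S S' 2 g).mpr h2),
    (algebraMap_mem_contactFiltration_iff h𝔪 f g b _).mpr hf⟩

/-! ## §2. The descent step from compatible faces -/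

/-- **Descent step, face form.**  `(x, y) = 𝔪` in `S` (dimension two on both sides, `𝔪 S' = 𝔪'`), `b, ν ≥ 1`,
`f ∉ 𝔪^{ν+1}` with level-`b` face `Σ a_j x^{b(ν-j)} y^j`; if the images `φ a_j` are congruent modulo `𝔪'` to a binomial row
`r' C(ν,j) μ'^{ν-j}` (`r', μ' ∈ S'`) and some `g' ∈ 𝔪' ∖ 𝔪'²` carries `φ f` to level `b+1`, then `f` reaches level `b+1`
in `S`.  (`r'` is a unit since `ord f = ν`; `μ'` is residually `κ`-rational by the residue-field lemma; steepen in `S`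
(K5); the prepared system either reaches `b+1` or, read in `S'`, contradicts C5 `not_mem_succ_of_caseC`.)
[cite: Hironaka1967, Thm. (well-preparedness)] -/
theorem reaches_succ_of_faces (h𝔪 : (maximalIdeal S).map (algebraMap S S') = maximalIdeal S')
    (hdim : ringKrullDim S = (2 : ℕ)) (hdim' : ringKrullDim S' = (2 : ℕ)) {x y : S}
    (hxy : Ideal.span {x, y} = maximalIdeal S) {b ν : ℕ} (hb : 1 ≤ b) (hν : 1 ≤ ν) {f : S}
    (hford : f ∉ maximalIdeal S ^ (ν + 1)) {a : ℕ → S}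
    (hface : f - ∑ j ∈ Finset.range (ν + 1), a j * (x ^ (b * (ν - j)) * y ^ j) ∈
      weightedMonomialIdeal ![x, y] ![1, b] (b * ν + 1))
    {r' μ' : S'} (hres : ∀ j ∈ Finset.range (ν + 1),
      algebraMap S S' (a j) - r' * (ν.choose j : S') * μ' ^ (ν - j) ∈ maximalIdeal S')
    {g' : S'} (hg' : g' ∈ maximalIdeal S') (hg'2 : g' ∉ maximalIdeal S' ^ 2)
    (hmem : algebraMap S S' f ∈ ⨆ j, Ideal.span {g' ^ j} * maximalIdeal S' ^ ((b + 1) * ν - (b + 1) * j)) :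
    Reaches f ν (b + 1) := by
  classical
  have hx : x ∈ maximalIdeal S := hxy ▸ Ideal.subset_span (by simp)
  have hy : y ∈ maximalIdeal S := hxy ▸ Ideal.subset_span (by simp)
  have hford' : algebraMap S S' f ∉ maximalIdeal S' ^ (ν + 1) := fun h =>
    hford ((mem_maximalIdeal_pow_iff_of_formallySmooth S S' _ f).mpr h)
  have hmemS : ∀ {z : S}, algebraMap S S' z ∈ maximalIdeal S' → z ∈ maximalIdeal S := fun {z} hz =>
    (IsLocalRing.mem_maximalIdeal _).mpr fun hu => (IsLocalRing.mem_maximalIdeal _).mp hz (hu.map (algebraMap S S'))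
  -- `r'` is a unit: otherwise every `a_j ∈ 𝔪` and `f ∈ 𝒥_b(bν+1) ⊆ 𝔪^{ν+1}`
  have hr' : IsUnit r' := by
    by_contra hr'
    have hr'm : r' ∈ maximalIdeal S' := (IsLocalRing.mem_maximalIdeal _).mpr hr'
    have ha : ∀ j ∈ Finset.range (ν + 1), a j ∈ maximalIdeal S := by
      intro j hj
      have h2 : r' * (ν.choose j : S') * μ' ^ (ν - j) ∈ maximalIdeal S' :=
        Ideal.mul_mem_right _ _ (Ideal.mul_mem_right _ _ hr'm)
      have h3 := Ideal.add_mem _ (hres j hj) h2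
      rw [sub_add_cancel] at h3
      exact hmemS h3
    have hfW := LocalGameEFTSteepening.sub_mul_steepen_pow_mem_of_face hxy hb hface (c := 0) (lam := 0)
      (fun j hj => by simpa using ha j hj)
    rw [zero_mul, sub_zero] at hfW
    exact hford (LocalGameEFTDimTwoGame.weightedMonomialIdeal_succ_le_pow hx hy hb ν hfW)
  -- the residue fields
  haveI := FormallySmoothField.formallySmooth_residueField (S := S) (S' := S') h𝔪
  haveI := FormallySmoothField.essFiniteType_residueField (S := S) (S' := S')
  have hK : ∀ j ≤ ν, algebraMap (ResidueField S) (ResidueField S') (residue S (a j)) =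
      residue S' r' * (ν.choose j : ResidueField S') * residue S' μ' ^ (ν - j) := by
    intro j hj
    have h := (residue_eq_zero_iff _).mpr (hres j (Finset.mem_range.mpr (Nat.lt_succ_of_le hj)))
    rw [map_sub, sub_eq_zero, map_mul, map_mul, map_natCast, map_pow] at h
    rw [IsLocalRing.ResidueField.algebraMap_residue]
    exact h
  have hc' : residue S' r' ≠ 0 := fun h => (IsLocalRing.mem_maximalIdeal _).mp ((residue_eq_zero_iff _).mp h) hr'
  obtain ⟨s, hs⟩ := FormallySmoothField.exists_algebraMap_eq_of_binomial_face (ResidueField S) (ResidueField S') hν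
    (fun j => residue S (a j)) hc' hK
  have hinj := (algebraMap (ResidueField S) (ResidueField S')).injective
  have hKν := hK ν le_rfl
  rw [Nat.choose_self, Nat.cast_one, mul_one, Nat.sub_self, pow_zero, mul_one] at hKν
  have hc : residue S (a ν) ≠ 0 := by
    intro h
    rw [h, map_zero] at hKν
    exact hc' hKν.symm
  have hP : ∀ j ∈ Finset.range (ν + 1),
      residue S (a j) = residue S (a ν) * (ν.choose j : ResidueField S) * (-(-s)) ^ (ν - j) := by
    intro j hj
    apply hinj
    rw [neg_neg, map_mul, map_mul, map_pow, map_natCast, hs, hKν,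
      hK j (Nat.lt_succ_iff.mp (Finset.mem_range.mp hj))]
  -- steepen in `S`
  obtain ⟨c, lam, hcu, -, -, hprep⟩ := LocalGameEFTSteepening.exists_steepen_of_face_eq_pow hxy hb hface hc hP
  obtain ⟨y₁, hy₁def⟩ : ∃ y₁ : S, y₁ = y - lam * x ^ b := ⟨_, rfl⟩
  have hxy₁ : Ideal.span {x, y₁} = maximalIdeal S := by
    rw [hy₁def, LocalGameEFTSteepening.span_pair_steepen_eq x y lam hb, hxy]
  have hprep₁ : f - c * y₁ ^ ν ∈ weightedMonomialIdeal ![x, y₁] ![1, b] (b * ν + 1) := by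
    rw [hy₁def, LocalGameEFTSteepening.weightedMonomialIdeal_steepen_eq]
    exact hprep
  have hy₁m : y₁ ∈ maximalIdeal S := hxy₁ ▸ Ideal.subset_span (by simp)
  have hy₁2 : y₁ ∉ maximalIdeal S ^ 2 := (LocalGameEFTSteepening.not_mem_sq_of_span_pair_eq hdim hxy₁).2
  by_cases hnext : f ∈ weightedMonomialIdeal ![x, y₁] ![1, b + 1] ((b + 1) * ν)
  · refine ⟨y₁, hy₁m, hy₁2, ?_⟩
    rw [contactFiltration_def, ← ContactFiltration.weightedMonomialIdeal_eq_contactFiltration hxy₁ (by omega)]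
    exact hnext
  · exfalso
    have hxy₁' := span_pair_map h𝔪 hxy₁
    have hprep' : algebraMap S S' f - algebraMap S S' c * algebraMap S S' y₁ ^ ν ∈
        weightedMonomialIdeal ![algebraMap S S' x, algebraMap S S' y₁] ![1, b] (b * ν + 1) := by
      have h := (algebraMap_mem_weightedMonomialIdeal_iff h𝔪 hxy₁ hb _ _).mpr hprep₁
      rwa [map_sub, map_mul, map_pow] at h
    have hnext' : algebraMap S S' f ∉
        weightedMonomialIdeal ![algebraMap S S' x, algebraMap S S' y₁] ![1, b + 1] ((b + 1) * ν) := fun h =>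
      hnext ((algebraMap_mem_weightedMonomialIdeal_iff h𝔪 hxy₁ (by omega) _ _).mp h)
    exact ContactFiltration.not_mem_succ_of_caseC hdim' hxy₁' hb hν (hcu.map (algebraMap S S')) hford' hprep' hnext'
      hg' hg'2 hmem

/-! ## §3. The descent step and the level sets -/

/-- **DESCENT STEP**: `f` reaches level `b` in `S` and `φ f` reaches level `b+1` in `S'` ⇒ `f` reaches level `b+1` in `S`
(`S → S'` local, formally smooth, essentially of finite type, both regular of dimension two, `𝔪 S' = 𝔪'`; `ν = ord f ≥ 1`,
`b ≥ 1`). [cite: Hironaka1967, Thm. (well-preparedness)] -/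
theorem reaches_succ_of_map_reaches_succ (h𝔪 : (maximalIdeal S).map (algebraMap S S') = maximalIdeal S')
    (hdim : ringKrullDim S = (2 : ℕ)) (hdim' : ringKrullDim S' = (2 : ℕ)) {f : S} {ν b : ℕ} (hν : 1 ≤ ν)
    (hb : 1 ≤ b) (hford : f ∉ maximalIdeal S ^ (ν + 1)) (hreach : Reaches f ν b)
    (hreach' : Reaches (algebraMap S S' f) ν (b + 1)) : Reaches f ν (b + 1) := by
  classical
  obtain ⟨y, hy, hy2, hfy⟩ := hreach
  have hd : (maximalIdeal S).spanFinrank = 2 := by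
    have h := IsRegularLocalRing.spanFinrank_maximalIdeal (R := S)
    rw [hdim] at h
    exact_mod_cast h
  obtain ⟨x, hxy⟩ := LocalGameEFTDimTwoGame.exists_span_pair_of_not_mem_sq hd hy hy2
  have hx : x ∈ maximalIdeal S := hxy ▸ Ideal.subset_span (by simp)
  obtain ⟨g', hg', hg'2, hmem⟩ := hreach'
  have hmem' : algebraMap S S' f ∈ ⨆ j, Ideal.span {g' ^ j} * maximalIdeal S' ^ ((b + 1) * ν - (b + 1) * j) := hmem
  have hxy' := span_pair_map h𝔪 hxy
  have hford' : algebraMap S S' f ∉ maximalIdeal S' ^ (ν + 1) := fun h =>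
    hford ((mem_maximalIdeal_pow_iff_of_formallySmooth S S' _ f).mpr h)
  have hfyW : f ∈ weightedMonomialIdeal ![x, y] ![1, b] (b * ν) := by
    rw [ContactFiltration.weightedMonomialIdeal_eq_contactFiltration hxy hb]
    exact hfy
  have hfyW' : algebraMap S S' f ∈ weightedMonomialIdeal ![algebraMap S S' x, algebraMap S S' y] ![1, b] (b * ν) :=
    (algebraMap_mem_weightedMonomialIdeal_iff h𝔪 hxy hb _ _).mpr hfyW
  rcases ContactFiltration.exists_face_of_mem_succ hdim' hxy' hb hν hford' hfyW' hg' hg'2 hmem' with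
    ⟨r', μ', hface', -⟩ | ⟨hb1, r', μ', -, hfx'⟩
  · -- the level-`b` face of `algebraMap S S' f` is the binomial row `r' (Y + μ' X^b)^ν`
    obtain ⟨a, hface⟩ := LocalGameEFTSteepening.exists_face hb hfyW
    have hfaceS' : algebraMap S S' f - ∑ j ∈ Finset.range (ν + 1),
        algebraMap S S' (a j) * (algebraMap S S' x ^ (b * (ν - j)) * algebraMap S S' y ^ j) ∈
          weightedMonomialIdeal ![algebraMap S S' x, algebraMap S S' y] ![1, b] (b * ν + 1) := by
      have h := (algebraMap_mem_weightedMonomialIdeal_iff h𝔪 hxy hb _ _).mpr hface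
      rwa [map_sub, map_face] at h
    have hdiff : ∑ j ∈ Finset.range (ν + 1), (algebraMap S S' (a j) - r' * (ν.choose j : S') * μ' ^ (ν - j)) *
        (algebraMap S S' x ^ (b * (ν - j)) * algebraMap S S' y ^ j) ∈
          weightedMonomialIdeal ![algebraMap S S' x, algebraMap S S' y] ![1, b] (b * ν + 1) := by
      have h := Ideal.sub_mem _ hface' hfaceS'
      rw [sub_sub_sub_cancel_left, ← Finset.sum_sub_distrib] at h
      simpa only [← sub_mul] using h
    have hres : ∀ j ∈ Finset.range (ν + 1),
        algebraMap S S' (a j) - r' * (ν.choose j : S') * μ' ^ (ν - j) ∈ maximalIdeal S' :=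
      fun j hj => LocalGameEFTSteepening.face_coeff_mem_maximalIdeal hdim' hxy' hb
        (fun j => algebraMap S S' (a j) - r' * (ν.choose j : S') * μ' ^ (ν - j)) hdiff
        (Nat.lt_succ_iff.mp (Finset.mem_range.mp hj))
    exact reaches_succ_of_faces h𝔪 hdim hdim' hxy hb hν hford hface hres hg' hg'2 hmem'
  · -- `b = 1` and the face is `r' μ'^ν X^ν`: swap the roles of `x` and `y`
    subst hb1
    have hyx : Ideal.span {y, x} = maximalIdeal S := by rw [Ideal.span_pair_comm]; exact hxy
    have hyx' := span_pair_map h𝔪 hyx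
    have hfν : f ∈ maximalIdeal S ^ ν := by
      have h := hfy
      rw [contactFiltration_one_weight hy, one_mul] at h
      exact h
    have hfxW : f ∈ weightedMonomialIdeal ![y, x] ![1, 1] (1 * ν) := by
      rw [ContactFiltration.weightedMonomialIdeal_eq_contactFiltration hyx le_rfl, ← contactFiltration_def,
        contactFiltration_one_weight hx, one_mul]
      exact hfν
    obtain ⟨a, hface⟩ := LocalGameEFTSteepening.exists_face (x := y) (y := x) le_rfl hfxW
    have hfaceS' : algebraMap S S' f - ∑ j ∈ Finset.range (ν + 1),
        algebraMap S S' (a j) * (algebraMap S S' y ^ (1 * (ν - j)) * algebraMap S S' x ^ j) ∈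
          weightedMonomialIdeal ![algebraMap S S' y, algebraMap S S' x] ![1, 1] (1 * ν + 1) := by
      have h := (algebraMap_mem_weightedMonomialIdeal_iff h𝔪 hyx le_rfl _ _).mpr hface
      rwa [map_sub, map_face] at h
    have hfx'' : algebraMap S S' f - (r' * μ' ^ ν) * algebraMap S S' x ^ ν ∈
        weightedMonomialIdeal ![algebraMap S S' y, algebraMap S S' x] ![1, 1] (1 * ν + 1) :=
      LocalGameEFTSteepening.sub_mem_weightedMonomialIdeal_one_of_sub_mem_pow hyx' hfx'
    have hfaceB := LocalGameEFTSteepening.face_of_sub_mul_pow_mem (x := algebraMap S S' y) hfx''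
    have hdiff : ∑ j ∈ Finset.range (ν + 1), (algebraMap S S' (a j) - (Pi.single ν (r' * μ' ^ ν) : ℕ → S') j) *
        (algebraMap S S' y ^ (1 * (ν - j)) * algebraMap S S' x ^ j) ∈
          weightedMonomialIdeal ![algebraMap S S' y, algebraMap S S' x] ![1, 1] (1 * ν + 1) := by
      have h := Ideal.sub_mem _ hfaceB hfaceS'
      rw [sub_sub_sub_cancel_left, ← Finset.sum_sub_distrib] at h
      simpa only [← sub_mul] using h
    have hcoef : ∀ j ≤ ν, algebraMap S S' (a j) - (Pi.single ν (r' * μ' ^ ν) : ℕ → S') j ∈ maximalIdeal S' :=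
      fun j hj =>
      LocalGameEFTSteepening.face_coeff_mem_maximalIdeal hdim' hyx' le_rfl
        (fun j => algebraMap S S' (a j) - (Pi.single ν (r' * μ' ^ ν) : ℕ → S') j) hdiff hj
    have hres : ∀ j ∈ Finset.range (ν + 1),
        algebraMap S S' (a j) - (r' * μ' ^ ν) * (ν.choose j : S') * (0 : S') ^ (ν - j) ∈ maximalIdeal S' := by
      intro j hj
      have hj' := Nat.lt_succ_iff.mp (Finset.mem_range.mp hj)
      rcases hj'.eq_or_lt with hjν | hlt
      · rw [hjν, Nat.sub_self, pow_zero, mul_one, Nat.choose_self, Nat.cast_one, mul_one]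
        have h := hcoef ν le_rfl
        rwa [Pi.single_eq_same] at h
      · have h := hcoef j hj'
        rw [Pi.single_eq_of_ne hlt.ne, sub_zero] at h
        rw [zero_pow (by omega), mul_zero, sub_zero]
        exact h
    exact reaches_succ_of_faces h𝔪 hdim hdim' hyx le_rfl hν hford hface hres hg' hg'2 hmem'

/-- **The contact levels of `f` and of `φ f` coincide** (`b ≥ 1`): ascent by transport, descent by induction on `b` along
the DESCENT STEP. [cite: Hironaka1967, Thm. (well-preparedness)] -/
theorem reaches_map_iff (h𝔪 : (maximalIdeal S).map (algebraMap S S') = maximalIdeal S')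
    (hdim : ringKrullDim S = (2 : ℕ)) (hdim' : ringKrullDim S' = (2 : ℕ)) {f : S} {ν : ℕ} (hν : 1 ≤ ν)
    (hfν : f ∈ maximalIdeal S ^ ν) (hford : f ∉ maximalIdeal S ^ (ν + 1)) {b : ℕ} (hb : 1 ≤ b) :
    Reaches (algebraMap S S' f) ν b ↔ Reaches f ν b := by
  refine ⟨fun h => ?_, reaches_map h𝔪⟩
  induction b, hb using Nat.le_induction with
  | base =>
    exact reaches_one hfν (IsRegularLocalRing.exists_not_mem_sq (by rw [hdim]; norm_num))
  | succ b hb ih =>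
    exact reaches_succ_of_map_reaches_succ h𝔪 hdim hdim' hν hb hford (ih (h.of_le (Nat.le_succ b))) h

/-! ## §4. The terminal level -/

omit [IsRegularLocalRing S] [IsRegularLocalRing S'] [Algebra S S'] [IsLocalHom (algebraMap S S')]
  [Algebra.FormallySmooth S S'] [Algebra.EssFiniteType S S'] in
/-- Bookkeeping: for `f ∈ 𝔪 ∖ 0` of a Noetherian local ring, `ν = (ord f).toNat` satisfies `1 ≤ ν`, `f ∈ 𝔪^ν`,
`f ∉ 𝔪^{ν+1}`. [folklore] -/
theorem adicOrder_toNat_spec [IsLocalRing S] [IsNoetherianRing S] {f : S} (hf0 : f ≠ 0) (hf : f ∈ maximalIdeal S) :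
    1 ≤ (adicOrder f).toNat ∧ f ∈ maximalIdeal S ^ (adicOrder f).toNat ∧
      f ∉ maximalIdeal S ^ ((adicOrder f).toNat + 1) := by
  set ν := (adicOrder f).toNat with hνdef
  have hνeq : adicOrder f = ν := (ENat.coe_toNat (adicOrder_ne_top hf0)).symm
  refine ⟨?_, (le_adicOrder_iff f ν).mp hνeq.symm.le, fun h => ?_⟩
  · have h' := (le_adicOrder_iff f 1).mpr (by rwa [pow_one])
    rw [hνeq] at h'
    exact_mod_cast h'
  · have h' := (le_adicOrder_iff f (ν + 1)).mpr h
    rw [hνeq] at h'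
    exact absurd (by exact_mod_cast h' : ν + 1 ≤ ν) (by omega)

/-- **`bMax (φ f) = bMax f`** for `f ∈ 𝔪 ∖ 0` along a local, formally smooth, essentially-of-finite-type homomorphism of
two-dimensional regular local rings with `𝔪 S' = 𝔪'` (the two `sSup`s range over the same set of levels, and
`ord (φ f) = ord f`, p503771). [cite: Hironaka1967, Thm. (well-preparedness)] -/
theorem bMax_map_eq (h𝔪 : (maximalIdeal S).map (algebraMap S S') = maximalIdeal S')
    (hdim : ringKrullDim S = (2 : ℕ)) (hdim' : ringKrullDim S' = (2 : ℕ)) {f : S} (hf0 : f ≠ 0)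
    (hf : f ∈ maximalIdeal S) : bMax (algebraMap S S' f) = bMax f := by
  rw [bMax_def, bMax_def, adicOrder_algebraMap_eq_of_formallySmooth S S' f]
  obtain ⟨hν, hfν, hford⟩ := adicOrder_toNat_spec hf0 hf
  congr 1
  ext b
  exact and_congr_right fun hb => reaches_map_iff h𝔪 hdim hdim' hν hfν hford hb

end Reflect

end EssSmoothLevels

end Summit.ResolutionOfSingularities.ResolutionOfSingularities.Theorems

end
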